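import Summits.HodgeConjecture.HodgeConjecture.Theorems.Ring2WeilCoverageNormTable
import Literature.NumberTheory.Waring.ThreeSquares
import Mathlib.LinearAlgebra.Matrix.Notation
import Mathlib.Data.Rat.Lemmas
import Mathlib.GroupTheory.Perm.Fin
import HarnessLib

/-!
# Weil-type family coverage — TYPE-III WINDOWS, part W (census block b04.32): the four type-III curves are curves of fourth powers of elliptic curves on `X₀(2)⁺` (THEOREM S34) — centroid discriminants, the split / definite quaternion envelopes, the rows `d ≢ 7 (mod 8)`, and the level-2 modular certificate

research route conditional on HC_CM; not a corollary; Q11.4-sentence-2 already refuted in dim ≥ 3.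

Ring 2, WEIL-TYPE FAMILY-COVERAGE CENSUS (`HOME/WEIL-FAMILY-COVERAGE.md` `## b04`, block b04.32, owner ring2-b04, gen 69).  SETTING (informal, NOT
formalised; THEOREMS-S33/S34 of the census): on each of the four «`SL₂`-type» Möbius-symmetric curves of the window `2.A₆∘C₄` (`K = ℚ(i)`; class tuples
`(3_2,3_2,x20_16,x20_18)#60`, `(3_2,3_2,x20_21,x20_22)#60`, `(3_2,3_2,x8_17,x8_17)#48`, `(3_2,3_2,x8_20,x8_20)#48`) the lifted algebra is Hamilton's
`ℍ = (-1,-1)_ℚ ⊂ End⁰(A_t)` with the canonical Rosati involution (S33.3).  THEOREM S34 (census engine `lie69.py`, ENGINE 9, exact over `ℚ`): the ℚ-Lie algebra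
`𝔤 = 𝔞𝔲𝔱(H¹(A_t;ℚ), E, ℍ)` (a ℚ-form of `𝔰𝔬*(4) = 𝔰𝔩₂(ℝ) ⊕ 𝔰𝔲(2)`) has a trace-zero centroid generator `φ₀` with `φ₀² = δ`, and `δ` is a SQUARE on all four
curves (`4/25`, `1/4`, `1/4`, `1/4`) — so `𝔤 = 𝔞 ⊕ 𝔟` splits over `ℚ`, with `𝔞 = 𝔰𝔩₁(B₁)` non-compact and `𝔟 = 𝔰𝔩₁(B₂)` compact, `B₁ = (-1,1/9), (-1,5/4), (-1,2),
(1,-1) ≅ M₂(ℚ)` SPLIT and `B₂ = (-1,-5/9), (-10/3,-1/6), (-1,-2), (-1,-2)` definite (`≅ ℍ`); by the weight argument (LEMMA S34.0) `MT(A_t) ⊂ GL_{B₁} = GL₂`, hence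
`A_t ∼ E_t⁴` at EVERY point — the curves are NOT simple type-III families (S33's open question), and the exact monodromy (ENGINE 10) puts the elliptic factor on
the modular curve `X₀(2)⁺ = X₀(2)/w₂` (projective monodromy `Γ₀(2)⁺`, kernel `Γ₀(2)` of index 3, congruence by Hsu's level-2 test); the control `ℚ(ζ₁₂)`-curve has
`δ = 3/4`, NOT a square (centroid the field `ℚ(√3)`: ℚ-simple, Hilbert-modular surface, S33.2).  Consequently (S34.4) the curves lie on the split row `W4.d.1` for
exactly the squarefree `d ≢ 7 (mod 8)` (`ℚ(√-d) ⊂ ℍ` iff `d` is a sum of three squares).  THIS FILE pins the literal arithmetic: §1 the centroid discriminants;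
§2 the splitting of `B₁` and the non-splitting of `B₂` as norm facts over `ℚ(i)` resp. `ℚ(√-30)` (the cell's `mem_normUnitsSubgroup_of_sq_add_mul_sq` /
`not_mem_normUnitsSubgroup_of_not_exists` and the landed `SqrtNeg1.mem_1/mem_2`, not restated); §3 the rows, on the tree's three-square law
`Literature.NumberTheory.Waring.not_sum_three_squares_of_mod_eight` (reused); §4 the level-2 modular certificate (the coset action of
`S, T` on `ℙ¹(𝔽₂)`, Hsu's three relations at `N = 2`, and the Fricke element `w = (0 2|-1 0)` normalising `⟨T², L⟩ = Γ⁰(2)`).  The Lie algebras, monodromy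
matrices, coset enumeration and period maps are computations / structure theorems of the census, not kernel facts; nothing here is a statement about Hodge
classes; `HC_CM` is used nowhere.

References: [cite: vanGeemen1994HodgeAV, 5.2 and (5.4.1)]; Hsu, Proc. AMS 124 (1996) 1351–1359 (congruence test; relations as reproduced in arXiv:1307.0625, p. 2).
-/

noncomputable section

set_option linter.dupNamespace false

open Literature.AlgebraicGeometry.Motives
open Literature.AlgebraicGeometry.VanGeemen1994
open Summit.HodgeConjecture.HodgeConjecture.Ring2.Hypotheses

namespace Summit.HodgeConjecture.HodgeConjecture.Ring2.WeilCoverage.TypeThreeElliptic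

/-! ### §1 The centroid discriminants `δ = φ₀²` of `𝔤 = 𝔞𝔲𝔱(H¹(A_t;ℚ), E, 𝒟)` (ENGINE 9): a square ⟺ `𝔤` splits over `ℚ` ⟺ `A_t ∼ E_t⁴` -/

/-- **Type-III curve `(3_2,3_2,x20_16,x20_18)` (orbit of size 60, window `2.A₆∘C₄`, `K = ℚ(i)`, lift `φ.sgn`, `𝒟 = ℍ`): the trace-zero centroid generator of the six-dimensional ℚ-Lie algebra `𝔤 = 𝔞𝔲𝔱(H¹(A_t;ℚ), E, ℍ)` has `φ₀² = 4/25`, a SQUARE — the centroid is `ℚ × ℚ`, `𝔤 = 𝔰𝔩₂(ℚ) ⊕ 𝔰𝔩₁(ℍ)`, and `A_t ∼ E_t⁴` (THEOREM S34.1, LEMMA S34.0)**: `4/25 = (2/5)²`.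
research route conditional on HC_CM; not a corollary; Q11.4-sentence-2 already refuted in dim ≥ 3. [cite: vanGeemen1994HodgeAV, 5.2] -/
theorem centroidDisc_x20_16_x20_18_isSquare : IsSquare ((4 : ℚ) / 25) :=
  ⟨2 / 5, by norm_num⟩

/-- **Type-III curves `(3_2,3_2,x20_21,x20_22)#60`, `(3_2,3_2,x8_17,x8_17)#48`, `(3_2,3_2,x8_20,x8_20)#48` (window `2.A₆∘C₄`, `K = ℚ(i)`, lift `φ.sgn`, `𝒟 = ℍ`): the centroid generator has `φ₀² = 1/4` on all three — a SQUARE: split centroid, `𝔤 = 𝔰𝔩₂(ℚ) ⊕ 𝔰𝔩₁(ℍ)`, `A_t ∼ E_t⁴` (THEOREM S34.1)**: `1/4 = (1/2)²`.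
research route conditional on HC_CM; not a corollary; Q11.4-sentence-2 already refuted in dim ≥ 3. [cite: vanGeemen1994HodgeAV, 5.2] -/
theorem centroidDisc_quarter_isSquare : IsSquare ((1 : ℚ) / 4) :=
  ⟨1 / 2, by norm_num⟩

/-- **CONTROL (ENGINE 9 on the `ℚ(ζ₁₂)`-curve `(3_2,3_2,x20_18,x20_21)#120`, FIX lift `φ`, `𝒟 = ℚ(ζ₁₂)`): `[𝔤,𝔤]` (dim 6, Killing signature (4,2,0)) has centroid generator with `φ₀² = 3/4`, NOT a square in `ℚ` — the centroid is the FIELD `ℚ(√3)`, `[𝔤,𝔤] = Res_{ℚ(√3)/ℚ}𝔰𝔩₂` is ℚ-simple, generic `End⁰ = ℚ(ζ₁₂)` (S33.2's Hilbert-modular surface of `ℚ(√3)`)**: if `3/4 = r²` then `3 = (2r)²` would be a rational, hence natural, square.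
research route conditional on HC_CM; not a corollary; Q11.4-sentence-2 already refuted in dim ≥ 3. [cite: vanGeemen1994HodgeAV, 5.2] -/
theorem centroidDisc_zeta12_not_isSquare : ¬ IsSquare ((3 : ℚ) / 4) := by
  rintro ⟨r, hr⟩
  have h3 : IsSquare ((3 : ℕ) : ℚ) := ⟨2 * r, by push_cast; linear_combination (4 : ℚ) * hr⟩
  rw [Rat.isSquare_natCast_iff] at h3
  obtain ⟨k, hk⟩ := h3
  have hk2 : k ≤ 2 := by nlinarith
  interval_cases k <;> omega

/-! ### §2 The two quaternion envelopes: `B₁` (non-compact ideal) SPLIT, `B₂` (compact ideal) not split — `(a,b)_ℚ ≅ M₂(ℚ)` iff `b ∈ Nm(ℚ(√a)ˣ)` -/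

/-- **Curve `(3_2,3_2,x20_16,x20_18)#60`: the envelope of the non-compact ideal is `B₁ = (-1, 1/9)_ℚ ≅ M₂(ℚ)` — SPLIT, so `MT(A_t) ⊂ GL₂` and `A_t ∼ E_t⁴`**: `1/9 = (1/3)² + 1·0² ∈ Nm(ℚ(i)ˣ)`.
research route conditional on HC_CM; not a corollary; Q11.4-sentence-2 already refuted in dim ≥ 3. [cite: vanGeemen1994HodgeAV, (5.4.1)] -/
theorem B1_x20_16_x20_18_mem :
    Units.mk0 ((1 : ℚ) / 9) (by norm_num) ∈ normUnitsSubgroup ℚ (weilField 1) :=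
  mem_normUnitsSubgroup_of_sq_add_mul_sq _ (1 / 3 : ℚ) (0 : ℚ) (by norm_num)

/-- **Curve `(3_2,3_2,x20_21,x20_22)#60`: `B₁ = (-1, 5/4)_ℚ ≅ M₂(ℚ)` — SPLIT, `A_t ∼ E_t⁴`**: `5/4 = 1² + 1·(1/2)² ∈ Nm(ℚ(i)ˣ)`.
research route conditional on HC_CM; not a corollary; Q11.4-sentence-2 already refuted in dim ≥ 3. [cite: vanGeemen1994HodgeAV, (5.4.1)] -/
theorem B1_x20_21_x20_22_mem :
    Units.mk0 ((5 : ℚ) / 4) (by norm_num) ∈ normUnitsSubgroup ℚ (weilField 1) :=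
  mem_normUnitsSubgroup_of_sq_add_mul_sq _ (1 : ℚ) (1 / 2 : ℚ) (by norm_num)

/-- **The non-compact envelopes `B₁` of ALL FOUR type-III curves are split — `(-1,1/9)`, `(-1,5/4)`, `(-1,2)`, `(1,-1) = (-1,1)`: `1/9, 5/4, 2, 1 ∈ Nm(ℚ(i)ˣ)` —, so `MT(A_t) ⊂ GL₂` and `A_t ∼ E_t⁴` on every one of them (THEOREM S34.1)**; for the two size-48 curves `(3_2,3_2,x8_17,x8_17)` (`b = 2 = 1²+1²`) and `(3_2,3_2,x8_20,x8_20)` (`b = 1`) the norm facts are the cell's landed `SqrtNeg1.mem_2`, `SqrtNeg1.mem_1` (`Ring2WeilCoverageNormTable`, reused, not restated).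
research route conditional on HC_CM; not a corollary; Q11.4-sentence-2 already refuted in dim ≥ 3. [cite: vanGeemen1994HodgeAV, (5.4.1)] -/
theorem B1_split_all_four :
    Units.mk0 ((1 : ℚ) / 9) (by norm_num) ∈ normUnitsSubgroup ℚ (weilField 1) ∧
    Units.mk0 ((5 : ℚ) / 4) (by norm_num) ∈ normUnitsSubgroup ℚ (weilField 1) ∧
    Units.mk0 (2 : ℚ) (by norm_num) ∈ normUnitsSubgroup ℚ (weilField 1) ∧
    Units.mk0 (1 : ℚ) (by norm_num) ∈ normUnitsSubgroup ℚ (weilField 1) :=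
  ⟨B1_x20_16_x20_18_mem, B1_x20_21_x20_22_mem, SqrtNeg1.mem_2, SqrtNeg1.mem_1⟩

/-- **Curve `(3_2,3_2,x20_16,x20_18)#60`: the envelope of the COMPACT ideal is `B₂ = (-1, -5/9)_ℚ`, NOT split (definite; ramified at `{2, ∞}`, `≅ ℍ`, and `[B₁]+[B₂] = [ℍ]` in `Br(ℚ)`)**: `-5/9 ∉ Nm(ℚ(i)ˣ)` since norms `x² + y²` are non-negative.
research route conditional on HC_CM; not a corollary; Q11.4-sentence-2 already refuted in dim ≥ 3. [cite: vanGeemen1994HodgeAV, (5.4.1)] -/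
theorem B2_x20_16_x20_18_not_mem :
    Units.mk0 ((-5 : ℚ) / 9) (by norm_num) ∉ normUnitsSubgroup ℚ (weilField 1) :=
  not_mem_normUnitsSubgroup_of_not_exists _ (by
    rintro ⟨x, y, h⟩
    push_cast at h
    nlinarith [sq_nonneg x, sq_nonneg y])

/-- **Curve `(3_2,3_2,x20_21,x20_22)#60`: `B₂ = (-10/3, -1/6)_ℚ = (-30, -6)_ℚ` (same symbol classes: `-10/3·3² = -30`, `-1/6·6² = -6`), NOT split (definite; ramified at `{2,∞}`, `≅ ℍ`)**: `-6 ∉ Nm(ℚ(√-30)ˣ)` since norms `x² + 30y²` are non-negative.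
research route conditional on HC_CM; not a corollary; Q11.4-sentence-2 already refuted in dim ≥ 3. [cite: vanGeemen1994HodgeAV, (5.4.1)] -/
theorem B2_x20_21_x20_22_not_mem :
    Units.mk0 (-6 : ℚ) (by norm_num) ∉ normUnitsSubgroup ℚ (weilField 30) :=
  not_mem_normUnitsSubgroup_of_not_exists _ (by
    rintro ⟨x, y, h⟩
    push_cast at h
    nlinarith [sq_nonneg x, sq_nonneg y])

/-- **Curves `(3_2,3_2,x8_17,x8_17)#48` and `(3_2,3_2,x8_20,x8_20)#48`: `B₂ = (-1, -2)_ℚ`, NOT split (definite; ramified at `{2,∞}`, `≅ ℍ`)**: `-2 ∉ Nm(ℚ(i)ˣ)`.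
research route conditional on HC_CM; not a corollary; Q11.4-sentence-2 already refuted in dim ≥ 3. [cite: vanGeemen1994HodgeAV, (5.4.1)] -/
theorem B2_x8_not_mem :
    Units.mk0 (-2 : ℚ) (by norm_num) ∉ normUnitsSubgroup ℚ (weilField 1) :=
  not_mem_normUnitsSubgroup_of_not_exists _ (by
    rintro ⟨x, y, h⟩
    push_cast at h
    nlinarith [sq_nonneg x, sq_nonneg y])

/-! ### §3 The rows of the `E_t⁴`-curves: `ℚ(√-d) ⊂ ℍ` (equivalently a Rosati-skew `ι` with `ι² = -d` in `pure(ℍ) ⊕ pure(B₂)`) iff `d` is a sum of three squares; for squarefree `d` iff `d ≢ 7 (mod 8)` (COROLLARY S34.4 (ii)) -/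

/-- **The excluded rows: `7, 15, 23` (the squarefree `d ≤ 30` with `d ≡ 7 (mod 8)`) are NOT sums of three squares — `ℚ(√-7), ℚ(√-15), ℚ(√-23) ⊄ ℍ`, so the `E_t⁴`-curves carry no polarised Weil structure over these fields (as S33.3 found for `d = 7, 15`)**; the three-square law `x² + y² + z² ≢ 7 (mod 8)` is the tree's `Literature.NumberTheory.Waring.not_sum_three_squares_of_mod_eight` [Hardy–Wright §20.10] (reused, not restated).
research route conditional on HC_CM; not a corollary; Q11.4-sentence-2 already refuted in dim ≥ 3. [cite: vanGeemen1994HodgeAV, 5.2] -/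
theorem excluded_rows_not_sum_three_squares :
    ∀ d ∈ ([7, 15, 23] : List ℕ), ∀ x y z : ℕ, x ^ 2 + y ^ 2 + z ^ 2 ≠ d := by
  intro d hd x y z
  simp only [List.mem_cons, List.mem_nil_iff, or_false] at hd
  rcases hd with rfl | rfl | rfl <;>
    exact Literature.NumberTheory.Waring.not_sum_three_squares_of_mod_eight (by norm_num) x y z

/-- **Every squarefree `d ≤ 30` with `d ≢ 7 (mod 8)` IS a sum of three squares** (explicit representations `d = x² + y² + z²`, entries `≤ 5`): the sixteen split rows `W4.d.1`, `d ∈ {1,2,3,5,6,10,11,13,14,17,19,21,22,26,29,30}`, on which the four `E_t⁴`-curves lie (S33.3 found the eleven with `d ∈ {1,2,3,5,6,10,11,13,14,21,30}`; `17, 19, 22, 26, 29` are new).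
research route conditional on HC_CM; not a corollary; Q11.4-sentence-2 already refuted in dim ≥ 3. [cite: vanGeemen1994HodgeAV, 5.2] -/
theorem rows_sum_three_squares :
    ∀ q ∈ ([(1, 1, 0, 0), (2, 1, 1, 0), (3, 1, 1, 1), (5, 2, 1, 0), (6, 2, 1, 1), (10, 3, 1, 0), (11, 3, 1, 1), (13, 3, 2, 0),
        (14, 3, 2, 1), (17, 4, 1, 0), (19, 3, 3, 1), (21, 4, 2, 1), (22, 3, 3, 2), (26, 5, 1, 0), (29, 5, 2, 0), (30, 5, 2, 1)] :
        List (ℕ × ℕ × ℕ × ℕ)), q.1 = q.2.1 ^ 2 + q.2.2.1 ^ 2 + q.2.2.2 ^ 2 := by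
  decide

/-! ### §4 The level-2 modular certificate (THEOREM S34.3): the coset action of `PSL₂(ℤ)` on `Γ⁰(2)\PSL₂(ℤ) = ℙ¹(𝔽₂)`, Hsu's relations at `N = 2`, and the Fricke element -/

/-- **The coset action of `PSL₂(ℤ)` on `Γ⁰(2)\\PSL₂(ℤ) = ℙ¹(𝔽₂) = {0, 1, ∞}` (coded `0, 1, 2`) found by ENGINE 10's Todd–Coxeter enumeration: `S = (0 -1|1 0)` acts by `z ↦ -1/z` (swaps `0 ↔ ∞`, fixes `1`), `T = (1 1|0 1)` (Hsu's `R`) by `z ↦ z+1` (swaps `0 ↔ 1`, fixes `∞`: cycle type (1,2) — cusp widths 1 and 2, level `N = 2`), Hsu's `L = (1 0|1 1) = S T⁻¹ S⁻¹` by `z ↦ z/(z+1)` (swaps `1 ↔ ∞`); the modular relations `S² = 1`, `(ST)³ = 1` hold** (a transitive `PSL₂(ℤ)`-set of size 3 with `e₂ = 1`, `e₃ = 0`: the coset space of a conjugate of `Γ₀(2)`).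
research route conditional on HC_CM; not a corollary; Q11.4-sentence-2 already refuted in dim ≥ 3. [cite: vanGeemen1994HodgeAV, 5.2] -/
theorem perm_relations :
    let S : Equiv.Perm (Fin 3) := Equiv.swap 0 2
    let T : Equiv.Perm (Fin 3) := Equiv.swap 0 1
    let L : Equiv.Perm (Fin 3) := S * T⁻¹ * S⁻¹
    S ^ 2 = 1 ∧ (S * T) ^ 3 = 1 ∧ T 2 = 2 ∧ T 0 = 1 ∧ S 1 = 1 ∧ L = Equiv.swap 1 2 := by
  refine ⟨?_, ?_, ?_, ?_, ?_, ?_⟩ <;> decide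

set_option maxRecDepth 20000 in
/-- **Hsu's congruence test at level `N = 2` (power-of-2 case; `1/5 ≡ 1 (mod 2)`, `S_H := L²⁰ R L⁻⁴ R⁻¹`, `A := L R⁻¹ L`, with `R = T`, `L = S T⁻¹ S⁻¹` acting on the three cosets): the three relations `A⁻¹ S_H A = S_H⁻¹`, `S_H⁻¹ R S_H = R²⁵`, `(S_H R⁵ L R⁻¹ L)³ = 1` hold — so the kernel `Ḡ₁` of the determinant-class character of the elliptic monodromy is a CONGRUENCE subgroup of level 2, `= Γ⁰(2)` (index 3), and `Ḡ = Γ⁰(2)⁺ ≅ Γ₀(2)⁺` (THEOREM S34.3)** [Hsu, Proc. AMS 124 (1996), Thm.; relations as in arXiv:1307.0625 p. 2].  (At level 2, `L² = R² = 1` on the cosets, so `S_H = 1` and the relations reduce to `(R L R L)³ = 1`.)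
research route conditional on HC_CM; not a corollary; Q11.4-sentence-2 already refuted in dim ≥ 3. [cite: vanGeemen1994HodgeAV, 5.2] -/
theorem hsu_level_two :
    let S : Equiv.Perm (Fin 3) := Equiv.swap 0 2
    let R : Equiv.Perm (Fin 3) := Equiv.swap 0 1
    let L : Equiv.Perm (Fin 3) := S * R⁻¹ * S⁻¹
    let SH := L ^ 20 * R * (L ^ 4)⁻¹ * R⁻¹
    let A := L * R⁻¹ * L
    A⁻¹ * SH * A = SH⁻¹ ∧ SH⁻¹ * R * SH = R ^ 25 ∧ (SH * R ^ 5 * L * R⁻¹ * L) ^ 3 = 1 := by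
  intro S R L
  have hL : L ^ 2 = 1 := by decide
  have hT : R ^ 2 = 1 := by decide
  have hL20 : L ^ 20 = 1 := by rw [show 20 = 2 * 10 from rfl, pow_mul, hL, one_pow]
  have hL4 : L ^ 4 = 1 := by rw [show 4 = 2 * 2 from rfl, pow_mul, hL, one_pow]
  have hT25 : R ^ 25 = R := by rw [show 25 = 2 * 12 + 1 from rfl, pow_add, pow_mul, hT, one_pow, one_mul, pow_one]
  have hT5 : R ^ 5 = R := by rw [show 5 = 2 * 2 + 1 from rfl, pow_add, pow_mul, hT, one_pow, one_mul, pow_one]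
  simp only [hL20, hL4, hT25, hT5]
  refine ⟨?_, ?_, ?_⟩ <;> decide

/-- **The Fricke element `w = (0 2|-1 0)` of the elliptic monodromy (determinant class 2; `w² = -2`, an involution in `PGL₂(ℚ)`) normalises `Γ⁰(2) = ⟨T², L⟩`: `w T² = L⁻¹ w` and `w L = T⁻² w` in `M₂(ℤ)`** (so `Ḡ = Γ⁰(2)·⟨w⟩ = Γ⁰(2)⁺`; on the double cover `B′ → B` the elliptic curve `E_t` with its `Γ₀(2)`-structure is defined, and the deck involution acts as `E_t ↦ E_t/C₂`).
research route conditional on HC_CM; not a corollary; Q11.4-sentence-2 already refuted in dim ≥ 3. [cite: vanGeemen1994HodgeAV, 5.2] -/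
theorem fricke_normalises :
    (!![0, 2; -1, 0] : Matrix (Fin 2) (Fin 2) ℤ) * !![1, 2; 0, 1] = !![1, 0; -1, 1] * !![0, 2; -1, 0] ∧
    (!![0, 2; -1, 0] : Matrix (Fin 2) (Fin 2) ℤ) * !![1, 0; 1, 1] = !![1, -2; 0, 1] * !![0, 2; -1, 0] ∧
    (!![0, 2; -1, 0] : Matrix (Fin 2) (Fin 2) ℤ) * !![0, 2; -1, 0] = !![-2, 0; 0, -2] := by
  refine ⟨?_, ?_, ?_⟩ <;> decide

/-- **The generators of `Ḡ₁` found by ENGINE 10 (`T^{±2}, T^{±4}, L^{±1}, L^{±2}` up to sign) all lie in `Γ⁰(2) = {(a b|c d) ∈ SL₂(ℤ) : b ≡ 0 (mod 2)}` and `T ∉ Γ⁰(2)`** — the containment half of `Ḡ₁ = Γ⁰(2)` (equality by the index count 3 = 3 of the coset enumeration).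
research route conditional on HC_CM; not a corollary; Q11.4-sentence-2 already refuted in dim ≥ 3. [cite: vanGeemen1994HodgeAV, 5.2] -/
theorem generators_upper_right_even :
    (∀ M ∈ ([!![1, 2; 0, 1], !![1, -2; 0, 1], !![1, 4; 0, 1], !![1, -4; 0, 1], !![1, 0; 1, 1], !![1, 0; -1, 1], !![1, 0; 2, 1],
        !![1, 0; -2, 1], !![-1, -2; 0, -1], !![-1, 0; -1, -1]] : List (Matrix (Fin 2) (Fin 2) ℤ)), 2 ∣ M 0 1 ∧ M.det = 1) ∧
    ¬ (2 : ℤ) ∣ (!![1, 1; 0, 1] : Matrix (Fin 2) (Fin 2) ℤ) 0 1 := by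
  refine ⟨?_, by decide⟩
  intro M hM
  simp only [List.mem_cons, List.mem_nil_iff, or_false] at hM
  rcases hM with rfl | rfl | rfl | rfl | rfl | rfl | rfl | rfl | rfl | rfl <;>
    exact ⟨by decide, by simp [Matrix.det_fin_two]⟩

end Summit.HodgeConjecture.HodgeConjecture.Ring2.WeilCoverage.TypeThreeElliptic

end
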